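import Mathlib
import Summits.Ventures.PercRepro2.SwOutCrossGenWeak
import Summits.Ventures.PercRepro2.SwOutCrossGenKEEdge

/-!
# The abstract inequality for THE MARK AT A DROPPED VERTEX (blind cell PercRepro2, night-4 g26,
2026-08-28; proofs/NIGHT4-G26.md §3)

With the mark `o = p q` a dropped vertex of the cross component, the conditioning
`Q = {h ∉ H_l, o ∈ C_R(l), o ∉ C_B(l)}` of a block point is no longer a function of the landed
type (NIGHT4-G25.md §7′ 3(b)): it reads the red links from `q` to the red ports whether or not `q`
is itself a red port, the blue links from the blue ports to `q`, and whether `q` lies in the red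
cluster of `h`.  THE MARK LABEL `labelKEM G q` records them: the landed label, the attachment bit
of `q`, the red ports red-linked to `q` (`RQ`) and the blue ports blue-linked to `q` (`BQ`); THE
MARK ORDER `BetterMark q` on the types `(s, label)` is the landed order with «`q` in the red cluster of
`h` (attached, some u-arm red) kept false upward», «`RQ` kept upward», «`BQ` kept downward» — an
order that depends on the u-arm bits, hence not a `FibreData` label order.  Its up-sets are closed
under the three moves of the abstract proof (`isUpW_of_isUpMark`: the two link facts are that the
vertices of a link between a red port and `q`, or between `q` and a blue port, are unattached at a
non-leaking point, so the slab injection re-links them through `u`), and **`card_le_crossKEEM`** is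
the abstract inequality of the mark-at-a-dropped-vertex block — by `card_le_crossGen'`, with no
new injection.  Census (own code mining/night-4/g26/markq_abs.py, markq_geo.py): 0 Hall failures
on every up-set of mark types (k ≤ 4, ι ≤ 3, 16 cases); the geometric type lemma for this order
0 violations on 136 random cross bases (15,766 non-leaking points, 883,922 pairs), where the
landed order has 3,819 violations; the naive enriched orders fail one side or the other.
-/

namespace Summit.Ventures.PercRepro2

namespace CrossArm

open LocRows

open scoped Classical

section Relabel

variable {W A L : Type*}

/-- **Relabelling a fibre data along a finer label** `f`, with `g` recovering the old label: the
label order compares the old labels. -/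
def FibreData.relabel (F : FibreData W A L) {L₂ : Type*} (f : W → L₂) (g : L₂ → L)
    (hg : ∀ w, g (f w) = F.label w) : FibreData W A L₂ where
  flip := F.flip
  flip_flip := F.flip_flip
  red := F.red
  leakR := F.leakR
  core := F.core
  label := f
  BetterL := fun l' l => F.BetterL (g l') (g l)
  betterL_refl := fun _ => F.betterL_refl _
  psi := F.psi
  core_of_noLeak := F.core_of_noLeak
  leakR_core := F.leakR_core
  leakR_flip_core := F.leakR_flip_core
  core_flip := F.core_flip
  psi_ok := fun w hr hc => by
    obtain ⟨h1, h2, h3, h4⟩ := F.psi_ok w hr hc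
    refine ⟨h1, h2, ?_, h4⟩
    rw [hg, hg]
    exact h3
  psi_inj := F.psi_inj
  core0 := F.core0
  core0_core := F.core0_core
  core_cases := F.core_cases
  flip_core0 := F.flip_core0
  pair_label := fun w hw => by
    have := F.pair_label w hw
    rw [hg, hg]
    exact this
  pair_red := F.pair_red

end Relabel

section Mark

variable {V : Type*} (G : SimpleGraph V)

/-- The mark labels: the landed label, the attachment bit of the mark, the red ports red-linked
to the mark, the blue ports blue-linked to the mark. -/
abbrev LabelKEM (V : Type*) := LabelKE V × Bool × (V → Prop) × (V → Prop)

/-- The mark label of a point. -/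
noncomputable def labelKEM (q : V) (w : FibKE V G) : LabelKEM V :=
  (labelKE G w, decide (attE G w q),
    fun j => w.2.2 j = false ∧ rlinkE G w q j,
    fun j => w.2.2 j = true ∧ rlinkE G w.flip q j)

/-- The landed label is the first component of the mark label. -/
lemma fst_labelKEM (q : V) (w : FibKE V G) : (labelKEM G q w).1 = labelKE G w := rfl

/-- **The mark order on types**: no more red u-arms; the landed order on the landed label; «the
mark in the red cluster of `h`» (attached with some u-arm red) kept false upward; the red ports
red-linked to the mark kept upward; the blue ports blue-linked to the mark kept downward. -/
def BetterMark {ι : Type*} (t' t : TypG (LabelKEM V) ι) : Prop :=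
  (∀ j, t.1 j = false → t'.1 j = false) ∧ BetterKE t'.2.1 t.2.1 ∧
    (t'.2.2.1 = true → redUG t'.1 → t.2.2.1 = true) ∧
    (∀ j, t.2.2.2.1 j → t'.2.2.2.1 j) ∧ (∀ j, t'.2.2.2.2 j → t.2.2.2.2 j)

/-- An up-set of types in the mark order. -/
def IsUpMark {ι : Type*} (𝒯 : Set (TypG (LabelKEM V) ι)) : Prop :=
  ∀ t ∈ 𝒯, ∀ t', BetterMark t' t → t' ∈ 𝒯

/-- The mark order is reflexive. -/
lemma betterMark_refl {ι : Type*} (t : TypG (LabelKEM V) ι) : BetterMark t t :=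
  ⟨fun _ h => h, BetterKE_refl _, fun h _ => h, fun _ h => h, fun _ h => h⟩

/-- Links depend only on the u-edge bits and the cross-edge colours. -/
lemma rlinkE_congr {w w' : FibKE V G} (h1 : w.1 = w'.1) (h2 : w.2.1 = w'.2.1) (i j : V) :
    rlinkE G w i j ↔ rlinkE G w' i j := by
  unfold rlinkE
  rw [GlinkE_congr G h1 h2]

/-- A vertex linked to an attached vertex is attached. -/
lemma attE_of_rlinkE {w : FibKE V G} {i j : V} (hij : rlinkE G w i j) (hj : attE G w j) :
    attE G w i :=
  SimpleGraph.Reachable.trans hij hj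

/-- Two vertices with red u-edges are linked (through `u`). -/
lemma rlinkE_of_uP {w : FibKE V G} {i j : V} (hi : w.1 i = true) (hj : w.1 j = true) :
    rlinkE G w i j :=
  SimpleGraph.Reachable.trans
    (SimpleGraph.Adj.reachable (show (GlinkE G w).Adj (some i) none from hi))
    (SimpleGraph.Adj.reachable (show (GlinkE G w).Adj none (some j) from hj))

/-- A red port of a point without red-side leak is unattached. -/
lemma not_attE_of_red_port {w : FibKE V G} (hr : leakKE G w = false) {j : V}
    (hj : w.2.2 j = false) : ¬ attE G w j := by
  intro ha
  rw [leakKE_eq_false_iff] at hr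
  rw [hr j ha] at hj
  exact Bool.noConfusion hj

/-- **The slab move keeps the red ports red-linked to the mark** (generic branch): at the source
both ends are unattached, so both get red u-edges and are linked through `u`. -/
lemma RQ_psiKE (q : V) {w : FibKE V G} (hr : leakKE G w = false) {j : V}
    (hj : w.2.2 j = false) (hl : rlinkE G w q j) :
    (psiKE G w).2.2 j = false ∧ rlinkE G (psiKE G w) q j := by
  by_cases hex : (∀ i, w.1 i = false) ∧ ∀ i, w.2.2 i = true
  · exfalso
    rw [hex.2 j] at hj
    exact Bool.noConfusion hj
  · rw [psiKE_generic G hex]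
    have haj : ¬ attE G w j := not_attE_of_red_port G hr hj
    have haq : ¬ attE G w q := fun h => haj (attE_of_rlinkE G hl.symm h)
    refine ⟨?_, ?_⟩
    · show (w.2.2 j && !decide (attE G w j)) = false
      rw [hj]; rfl
    · have huq : (!w.1 q) = true := by rw [uP_eq_false_of_not_attE G haq]; rfl
      have huj : (!w.1 j) = true := by rw [uP_eq_false_of_not_attE G haj]; rfl
      exact rlinkE_of_uP G (w := (fun i => !w.1 i, fun s => !w.2.1 s,
        fun i => w.2.2 i && !decide (attE G w i))) huq huj

/-- **The slab move keeps the blue ports blue-linked to the mark downward** (generic branch):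
a blue port of the image is an unattached blue port of the source red-linked to the mark, and at
the source both ends have blue u-edges, so they are blue-linked through `u`. -/
lemma BQ_psiKE (q : V) {w : FibKE V G} {j : V}
    (hj : (psiKE G w).2.2 j = true) (hl : rlinkE G (psiKE G w).flip q j) :
    w.2.2 j = true ∧ rlinkE G w.flip q j := by
  by_cases hex : (∀ i, w.1 i = false) ∧ ∀ i, w.2.2 i = true
  · exfalso
    rw [psiKE_exc G hex] at hj
    exact Bool.noConfusion hj
  · have hflip := flip_psiKE_generic G hex
    rw [psiKE_generic G hex] at hj
    have hj' : w.2.2 j = true ∧ ¬ attE G w j := by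
      have : (w.2.2 j && !decide (attE G w j)) = true := hj
      simpa using this
    have hl' : rlinkE G w q j := by
      rw [hflip] at hl
      exact (rlinkE_congr G rfl rfl q j).1 hl
    have haq : ¬ attE G w q := fun h => hj'.2 (attE_of_rlinkE G hl'.symm h)
    refine ⟨hj'.1, ?_⟩
    have huq : w.flip.1 q = true := by
      show (!w.1 q) = true
      rw [uP_eq_false_of_not_attE G haq]; rfl
    have huj : w.flip.1 j = true := by
      show (!w.1 j) = true
      rw [uP_eq_false_of_not_attE G hj'.2]; rfl
    exact rlinkE_of_uP G huq huj

variable [Fintype V] [DecidableEq V] [DecidableRel G.Adj] [Nonempty V]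

/-- **The fibre data with edge atoms and the mark label.** -/
noncomputable def fibKEEM (hG : G.Connected) (q : V) :
    FibreData (FibKE V G) (AtomKEE V G) (LabelKEM V) :=
  (fibKEE G hG).relabel (labelKEM G q) Prod.fst (fun _ => rfl)

/-- **Every up-set of the mark order is closed under the three moves of the abstract proof.** -/
theorem isUpW_of_isUpMark (hG : G.Connected) (q : V) {ι : Type*}
    {𝒯 : Set (TypG (LabelKEM V) ι)} (h : IsUpMark 𝒯) : IsUpW (fibKEEM G hG q) 𝒯 := by
  refine ⟨fun s s' l hs hl => h _ hl _ ⟨hs, BetterKE_refl _, fun h' _ => h', fun _ h' => h',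
    fun _ h' => h'⟩, fun w hw s hs => h _ hs _ ?_, fun w hr hc ht => h _ ht _ ?_⟩
  · -- the core pairing: the lower core point has everything dropped and all outside edges red
    have hw' : (∀ i, w.1 i = false) ∧ ∀ i, w.2.2 i = false := (mem_core0KE G).1 hw
    refine ⟨fun _ h' => h', pair_labelKE G w hw, fun hq _ => ?_, fun j hj => ?_, fun j hj => ?_⟩
    · exfalso
      have : attE G w q := by simpa [fibKEEM, FibreData.relabel, labelKEM] using hq
      exact not_attE_of_uP_false G hw'.1 q this
    · exfalso
      have hj' : (FibKE.flip w).2.2 j = false := hj.1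
      have : (!w.2.2 j) = false := hj'
      rw [hw'.2 j] at this
      exact Bool.noConfusion this
    · exfalso
      have hj' : w.2.2 j = true := hj.1
      rw [hw'.2 j] at hj'
      exact Bool.noConfusion hj'
  · -- the slab move
    have hr' : leakKE G w = false := hr
    have hc' : coreKE w = false := hc
    refine ⟨fun j hj => ?_, (psiKE_ok G w hr' hc').2.2.1, fun _ hred => ?_, fun j hj => ?_,
      fun j hj => ?_⟩
    · exact absurd hj (by simp [sTopG])
    · exact absurd hred not_redUG_bot
    · exact RQ_psiKE G q hr' hj.1 hj.2
    · exact BQ_psiKE G q hj.1 hj.2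

open scoped Classical in
/-- **THE ABSTRACT INEQUALITY FOR THE MARK AT A DROPPED VERTEX**: on every up-set of the mark
order, the red count is at most the blue count for every up-set of atom sets. -/
theorem card_le_crossKEEM (hG : G.Connected) (q : V) {ι : Type*} [Fintype ι] [DecidableEq ι]
    [Nonempty ι] {𝒯 : Set (TypG (LabelKEM V) ι)} (h𝒯 : IsUpMark 𝒯)
    {𝓔 : Set (Set (AtomG (AtomKEE V G) ι))} (h𝓔 : IsUpperSet 𝓔) :
    ((QG (fibKEEM G hG q) 𝒯).filter fun x => ERG (fibKEEM G hG q) x ∈ 𝓔).card ≤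
      ((QG (fibKEEM G hG q) 𝒯).filter fun x => EBG (fibKEEM G hG q) x ∈ 𝓔).card :=
  card_le_crossGen' (isUpW_of_isUpMark G hG q h𝒯) h𝓔

end Mark

end CrossArm

end Summit.Ventures.PercRepro2
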